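import Summits.Ventures.PercRepro.ProfileGapMonoThresholdExcess

/-!
# PercRepro — THE NULLITY REGIME OF THE THRESHOLD FAMILY: no rank-`(q−1)` flat larger than the nullity
(p5, gen 29; `proofs/P5-GM1.md` §33(d′); announced INBOX 13468 / owner line 13481)

The closure excess of a rank-`(q−1)` set `B` is `ρ(E∖B) − #(E ∖ cl B) = #(cl B ∖ B) − ν(E∖B) ≤ #(cl B) − ν(E)`
(`ν` = nullity): it is `≤ 0` as soon as the nullity of `N` is at least the size of the flat `cl B`.  So the threshold
family `(I_t)` holds at EVERY offset `t ≥ 0` on every finite matroid whose nullity `#E − ρ(E)` is at least the size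
of its largest rank-`(q−1)` flat (`thresholdIneq_of_flat_card_le_nullity`); at co-rank `3`: every line has at most
`ν(N)` points (`thresholdIneq_three_of_line_card_le_nullity`).  The hard core of the family at co-rank `q` is
therefore the matroids with a rank-`(q−1)` flat `F` with `#F > ν(N)`, i.e. `#E < ρ(E) + #F`.

* `rk_sdiff_le_card_sdiff_clF_of_nullity`, **`thresholdIneq_of_flat_card_le_nullity`**,
  `thresholdIneq_of_card_le_nullity`, **`thresholdIneq_three_of_line_card_le_nullity`**.
-/

open scoped Matroid

namespace PercRepro.Cogirth

open Finset ThmH Skew Shadow Profile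

variable {α : Type} [DecidableEq α] {N : Matroid α} [N.Finite]

section Nullity

variable {q t : ℕ}

/-- **No excess when the flat fits in the nullity**: if `#(cl B) + ρ(E) ≤ #E`, then `ρ(E∖B) ≤ #(E ∖ cl B)`
(`ρ(E∖B) ≤ ρ(E) ≤ #E − #(cl B)`). -/
theorem rk_sdiff_le_card_sdiff_clF_of_nullity (B : Finset α)
    (h : (clF N B).card + rk N (gr N) ≤ (gr N).card) : rk N (gr N \ B) ≤ (gr N \ clF N B).card := by
  have h1 : rk N (gr N \ B) ≤ rk N (gr N) := rk_mono' sdiff_subset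
  have h2 : (gr N \ clF N B).card = (gr N).card - (clF N B).card :=
    card_sdiff_of_subset (clF_subset_gr B)
  have h3 : (clF N B).card ≤ (gr N).card := card_le_card (clF_subset_gr B)
  omega

/-- **The nullity regime** (`1 ≤ q`, every `t ≥ 0`): if every rank-`(q−1)` flat `cl B` satisfies
`#(cl B) + ρ(E) ≤ #E` — the nullity of `N` is at least the size of every rank-`(q−1)` flat — then `(I_t)` holds. -/
theorem thresholdIneq_of_flat_card_le_nullity (hq : 1 ≤ q)
    (h : ∀ B ∈ Rq N (q - 1), (clF N B).card + rk N (gr N) ≤ (gr N).card) : ThresholdIneq N q t :=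
  thresholdIneq_of_rk_sdiff_le_card hq
    (fun B hB => rk_sdiff_le_card_sdiff_clF_of_nullity B (h B hB))

/-- **A uniform version**: if every rank-`(q−1)` flat has at most `m` elements and `m + ρ(E) ≤ #E`, then `(I_t)`
holds at every offset (`1 ≤ q`). -/
theorem thresholdIneq_of_card_le_nullity (hq : 1 ≤ q) {m : ℕ}
    (hm : ∀ B ∈ Rq N (q - 1), (clF N B).card ≤ m) (h : m + rk N (gr N) ≤ (gr N).card) :
    ThresholdIneq N q t :=
  thresholdIneq_of_flat_card_le_nullity hq (fun B hB => by have := hm B hB; omega)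

/-- **Co-rank `3`: lines no longer than the nullity** — if every rank-`2` set `B` has `#(cl B) + ρ(E) ≤ #E`, the whole
family `(I_t)` at `q = 3` holds at every offset. -/
theorem thresholdIneq_three_of_line_card_le_nullity
    (h : ∀ B ∈ Rq N 2, (clF N B).card + rk N (gr N) ≤ (gr N).card) : ThresholdIneq N 3 t :=
  thresholdIneq_of_flat_card_le_nullity (by norm_num) h

end Nullity

end PercRepro.Cogirth
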